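import Summits.PneNP.PneNP.Theses.OneSlice
import Summits.PneNP.PneNP.Theorems.OneSliceAssembly
import Summits.PneNP.PneNP.Theorems.OneSliceSliceMonotonization
import Summits.PneNP.PneNP.Theorems.OneSliceCliqueCircuitsOfNPSubsetPPoly
import Summits.PneNP.PneNP.Theorems.OneSliceSliceTargetTransfer
import Summits.PneNP.PneNP.Theorems.OneSliceSliceTargetSliceTouch
import Summits.PneNP.PneNP.Theorems.OneSliceSliceTargetFibreMin
import Summits.PneNP.PneNP.Theorems.OneSliceSliceTargetFibreCliqueLower
import Summits.PneNP.PneNP.Theorems.OneSliceSliceTargetFibreCliqueUpper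
import Summits.PneNP.PneNP.Theorems.OneSliceSliceTargetQuarter

/-!
# Certificate (lead c3-0, line `Sketch-ideator3-r1`, crux stmt-PneNP-2832): the one open stub T9 has P ≠ NP strength

Everything used below is an ACCEPTED tree theorem (std axioms): the locality floor `sliceLB_of_locality` + T1–T4 (p86895,
p87365, p86862, p97074/p97251, p87716), the quarter floor / window reduction `sliceTargetFrom2_of_quarter`,
`quarter_of_sliceTargetFrom2` (p96336), `oneSlice_assembly_proof` (item 10382, p82434), `sliceMonotonization_proof`
(item 2836, p78537), `cliqueCircuitsOfNPSubsetPPoly_proof` (item 2837). (Same content as `sliceTarget_iff_sliceHardQuarter`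
of `OneSliceSliceTargetReduction.lean`, p100099, re-derived here from its imports because that module was not yet built on the
farm snapshot.) So the registered residual stub of the line implies `PneNP` by name and is implied by the crux:
T9 ⟺ SliceTarget ⟹ PneNP.
-/

set_option linter.dupNamespace false

namespace Summit.PneNP.PneNP.Cruxes.SliceTarget.Ideator3Line

open Literature.Computability.Complexity Finset Filter Classical
open Summit.PneNP.PneNP.Theorems.ConstantBand.Negative (Edge Central slice errSet)

/-- T9 (the registered stub `stub_sliceHardQuarter`, verbatim signature) implies the crux through tree theorems only. -/
theorem sliceTarget_of_T9
    (h₉ : ∀ c : ℕ, 2 ≤ c → ∃ k : ℕ, 3 ≤ k ∧ ∃ δ : ℝ, 0 < δ ∧ ∀ᶠ n : ℕ in atTop, ∀ j : ℕ, Central k n j →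
      ∀ C : Circuit (Edge n), C.IsOver monotoneBasis → n.choose 2 ≤ 4 * C.size + 1 →
        (#(errSet n k j C) : ℝ) ≤ δ * #(slice n j) → n ^ c < C.size) :
    Summit.PneNP.PneNP.Theses.OneSlice.SliceTarget := by
  intro c
  by_cases hc : c ≤ 1
  · obtain ⟨δ, hδ, h⟩ := sliceLB_of_locality hc stub_sliceTouch stub_fibreMin stub_fibreCliqueLower stub_fibreCliqueUpper
    exact ⟨4, by norm_num, δ, hδ, h⟩
  · exact sliceTargetFrom2_of_quarter h₉ c (by omega)

/-- T9 implies `PneNP` through tree theorems only. -/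
theorem pneNP_of_T9
    (h₉ : ∀ c : ℕ, 2 ≤ c → ∃ k : ℕ, 3 ≤ k ∧ ∃ δ : ℝ, 0 < δ ∧ ∀ᶠ n : ℕ in atTop, ∀ j : ℕ, Central k n j →
      ∀ C : Circuit (Edge n), C.IsOver monotoneBasis → n.choose 2 ≤ 4 * C.size + 1 →
        (#(errSet n k j C) : ℝ) ≤ δ * #(slice n j) → n ^ c < C.size) : _root_.PneNP :=
  Summit.PneNP.PneNP.Theorems.oneSlice_assembly_proof Summit.PneNP.PneNP.Theorems.sliceMonotonization_proof
    Summit.PneNP.PneNP.Theorems.cliqueCircuitsOfNPSubsetPPoly_proof (sliceTarget_of_T9 h₉)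

/-- And the crux gives T9 back, so nothing weaker than the crux is left in the line: T9 ⟺ SliceTarget. -/
theorem sliceTarget_iff_T9 : Summit.PneNP.PneNP.Theses.OneSlice.SliceTarget ↔
    (∀ c : ℕ, 2 ≤ c → ∃ k : ℕ, 3 ≤ k ∧ ∃ δ : ℝ, 0 < δ ∧ ∀ᶠ n : ℕ in atTop, ∀ j : ℕ, Central k n j →
      ∀ C : Circuit (Edge n), C.IsOver monotoneBasis → n.choose 2 ≤ 4 * C.size + 1 →
        (#(errSet n k j C) : ℝ) ≤ δ * #(slice n j) → n ^ c < C.size) :=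
  ⟨fun hX => quarter_of_sliceTargetFrom2 fun c _ => hX c, sliceTarget_of_T9⟩

end Summit.PneNP.PneNP.Cruxes.SliceTarget.Ideator3Line
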